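import Mathlib
import HarnessLib
import Summits.HubbardSuperconductivity.HubbardSuperconductivity.Theorems.KLProgrammeKLRegimeSplitEdgeFactsComplMemberJets
import Summits.HubbardSuperconductivity.HubbardSuperconductivity.Theorems.KLProgrammeKLRegimeSplitEdgeFactsBubblePin

/-!
# Route `KLProgramme` — edge facts for the pair masses ACROSS TRANSFERS, XIII: the PINNED FLOOR of the complementary members' net mass, CONDITIONAL on a
# phase-space LAYER COUNT — `c₀·βL²·Λ_n² ≤ #{k : Λ_n²/2 ≤ ω_k² + e_K² ≤ 3Λ_n²/4} ⟹ (64/243)·c₀ ≤ −Σ_p t_n[s_{n,m}](0,p)`, uniformly in `n, m ≥ n+1`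
# (the per-step case `s₀ = 0` of S2-ROWS (D3′), reduced to the ONE geometric input E1 owes: a density-of-states FLOOR on the shell)

Cell gate-hubbard-kl, seat hubbard-kl-k3c1-p1 (g21; child-1 lineage).  Row 15 (`klTransferWeight_pin_eq`) writes the pinned net mass of a member as the nonnegative
overlap `−Σ_p t_n[φ](0,p) = 2(βL²)⁻¹·Σ_{ν,p} w_{Λ_n}(ν,p)·φ(ν,p)·‖ĝ_K(ν,p)‖²`.  For the complementary member `φ = s_{n,m} = w_{Λ_m} − w_{Λ_n}`, `m ≥ n+1`, the lower weight is
FLAT on the layer `{Λ_n²/2 ≤ ω² + e_K² ≤ 3Λ_n²/4}` (`…ComplMemberJets.klcd_soft_eq_one_sub`), so there `φ = 1 − w_{Λ_n}` and the overlap density is `w(1 − w)/(ω² + e²)` with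
`w = χ₂(x)`, `x ∈ [1/2, 3/4]`:
* §1 `χ₂` on the layer: **`1/9 ≤ χ₂(x) ≤ 8/9` for `x ∈ [1/2, 3/4]`** (`χ₂(x) = σ((4x−1)/3)`, `σ(t) = 1/(1 + exp(1/t − 1/(1−t)))`-type with `|1/t − 1/(1−t)| ≤ 3/2` on
  `t ∈ [1/3, 2/3]`, and `exp(3/2) ≤ exp(1)² < 8`), hence `w(1 − w) ≥ 8/81`;
* §2 pointwise: on the layer **`(8/81)·(4/(3Λ_n²)) ≤ w_{Λ_n}·s_{n,m}·‖ĝ_K‖²`**, and `0 ≤ w_{Λ_n}·s_{n,m}·‖ĝ_K‖²` everywhere (`s_{n,m} ≥ 0` by `monotone_salmhoferCutoff`);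
* §3 **`klpf_pinned_mass_floor`**: `0 < β`, `n + 1 ≤ m`, `c₀·(βL²)·Λ_n² ≤ #layer` ⟹ `(64/243)·c₀ ≤ −Σ_p t_n[s_{n,m}](0,p)` (the `βL²Λ_n²` CANCELS: `b_lo = 64c₀/243`, n-uniform);
* §4 `klpf_layer_card_ge`: the layer contains the product `{ν : ω_ν² ≤ Λ_n²/8} × {p : Λ_n²/2 ≤ e_K(p)² ≤ 5Λ_n²/8}`, so a Matsubara count times a LEVEL-SET FLOOR
  `#{p : Λ_n/√2 ≤ |e_K(p)| ≤ √(5/8)Λ_n} ≳ Λ_n L²` (the Fermi-curve length — E1's μ-window input; no such floor exists in the tree) gives the hypothesis of §3.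
Everything is proved; no definitions; nothing asserts any slot, stub, K3 or SC. [folklore]
-/

noncomputable section

namespace Summit.HubbardSuperconductivity.HubbardSuperconductivity.Theorems.KLRegimeSplit

set_option linter.dupNamespace false -- summit = problem name (single-conjunct summit), D-0017

open Real Finset Literature.MathematicalPhysics.QuantumLattice Literature.Probability.LatticeModels
open Literature.MathematicalPhysics.QuantumLattice.FermiRG
open Summit.HubbardSuperconductivity.HubbardSuperconductivity.Theorems.KLProgrammeLegKernels
open Summit.HubbardSuperconductivity.HubbardSuperconductivity.Theorems.TwoPointAssembly

/-! ## §1 Salmhofer's cutoff on the layer `x ∈ [1/2, 3/4]` -/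

/-- `exp(3/2) ≤ 8` (`exp(3/2) ≤ exp(1)² < 2.7182818286² < 8`). [folklore] -/
theorem klpf_exp_three_halves_le : Real.exp (3 / 2) ≤ 8 := by
  have h1 := Real.exp_one_lt_d9
  have h2 : Real.exp 2 = Real.exp 1 * Real.exp 1 := by rw [← Real.exp_add]; norm_num
  have h3 : Real.exp (3 / 2) ≤ Real.exp 2 := Real.exp_le_exp.2 (by norm_num)
  have h0 : 0 < Real.exp 1 := Real.exp_pos 1
  nlinarith

/-- **The cutoff on the layer**: `1/2 ≤ x ≤ 3/4` ⟹ `1/9 ≤ χ₂(x) ≤ 8/9`. [folklore] -/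
theorem klpf_salmhoferCutoff_window {x : ℝ} (hx : 1 / 2 ≤ x) (hx' : x ≤ 3 / 4) : 1 / 9 ≤ salmhoferCutoff x ∧ salmhoferCutoff x ≤ 8 / 9 := by
  set t := (4 * x - 1) / 3 with ht
  have ht1 : 1 / 3 ≤ t := by rw [ht]; linarith
  have ht2 : t ≤ 2 / 3 := by rw [ht]; linarith
  have htp : 0 < t := by linarith
  have htp' : 0 < 1 - t := by linarith
  have ha : expNegInvGlue t = Real.exp (-t⁻¹) := by simp [expNegInvGlue, not_le.2 htp]
  have hb : expNegInvGlue (1 - t) = Real.exp (-(1 - t)⁻¹) := by simp [expNegInvGlue, not_le.2 htp']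
  set a := Real.exp (-t⁻¹) with hadef
  set b := Real.exp (-(1 - t)⁻¹) with hbdef
  have ha0 : 0 < a := Real.exp_pos _
  have hb0 : 0 < b := Real.exp_pos _
  -- `1/t ≤ 3`, `1/(1−t) ≤ 3`, `1/t ≥ 3/2`, `1/(1−t) ≥ 3/2`
  have hti : t⁻¹ ≤ 3 := by rw [inv_le_comm₀ htp (by norm_num)]; linarith
  have hti' : (1 - t)⁻¹ ≤ 3 := by rw [inv_le_comm₀ htp' (by norm_num)]; linarith
  have htj : 3 / 2 ≤ t⁻¹ := by rw [le_inv_comm₀ (by norm_num) htp]; linarith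
  have htj' : 3 / 2 ≤ (1 - t)⁻¹ := by rw [le_inv_comm₀ (by norm_num) htp']; linarith
  have h8 := klpf_exp_three_halves_le
  -- `b ≤ 8a` and `a ≤ 8b`
  have hba : b ≤ 8 * a := by
    have : b = a * Real.exp (t⁻¹ - (1 - t)⁻¹) := by
      rw [hadef, hbdef, ← Real.exp_add]; congr 1; ring
    rw [this]
    have he : Real.exp (t⁻¹ - (1 - t)⁻¹) ≤ 8 := (Real.exp_le_exp.2 (by linarith)).trans h8
    nlinarith
  have hab : a ≤ 8 * b := by
    have : a = b * Real.exp ((1 - t)⁻¹ - t⁻¹) := by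
      rw [hadef, hbdef, ← Real.exp_add]; congr 1; ring
    rw [this]
    have he : Real.exp ((1 - t)⁻¹ - t⁻¹) ≤ 8 := (Real.exp_le_exp.2 (by linarith)).trans h8
    nlinarith
  have hval : salmhoferCutoff x = a / (a + b) := by
    rw [salmhoferCutoff, Real.smoothTransition, ← ht, ha, hb]
  rw [hval]
  have hab0 : 0 < a + b := by positivity
  constructor
  · rw [div_le_div_iff₀ (by norm_num) hab0]; linarith
  · rw [div_le_div_iff₀ hab0 (by norm_num)]; linarith

/-! ## §2 The overlap density on the layer -/

section Floor

variable {L M : ℕ} [NeZero L] (β μ : ℝ) (K : TrigPolyC4v)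

omit [NeZero L] in
/-- The complementary member is nonnegative: `n ≤ m` ⟹ `0 ≤ s_{n,m}(k) = w_{Λ_m}(k) − w_{Λ_n}(k)` (`Λ_m ≤ Λ_n`, `χ₂` monotone). [folklore] -/
theorem klpf_soft_nonneg [NeZero M] {n m : ℕ} (hnm : n ≤ m) (k : FreqMomentum L M) : 0 ≤ softSymbolCompl L M β μ K n m k := by
  have hΛm := klth_klScale_pos m
  have hmn : klScale klE0 m ≤ klScale klE0 n := by
    simp only [klScale]
    exact mul_le_mul_of_nonneg_left (inv_anti₀ (by positivity) (pow_le_pow_right₀ (by norm_num) hnm)) (by norm_num [klE0])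
  simp only [softSymbolCompl, hubbardCutoffWeightCT, sub_nonneg]
  refine monotone_salmhoferCutoff ?_
  have hr : 0 ≤ matsubaraFreq β M k.1 ^ 2 + nambuXiCT L μ K k.2 ^ 2 := by positivity
  exact div_le_div_of_nonneg_left hr (by positivity) (pow_le_pow_left₀ hΛm.le hmn 2)

omit [NeZero L] in
/-- **The overlap density is nonnegative**: `0 ≤ w_{Λ_n}(k)·s_{n,m}(k)·‖ĝ_K(k)‖²` (`n ≤ m`). [folklore] -/
theorem klpf_density_nonneg [NeZero M] {n m : ℕ} (hnm : n ≤ m) (k : FreqMomentum L M) :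
    0 ≤ hubbardCutoffWeightCT L M β μ K (klScale klE0 n) k * softSymbolCompl L M β μ K n m k * ‖propCT L M β μ K k‖ ^ 2 :=
  mul_nonneg (mul_nonneg (salmhoferCutoff_mem_Icc _).1 (klpf_soft_nonneg β μ K hnm k)) (sq_nonneg _)

omit [NeZero L] in
/-- **The overlap density on the layer**: `n + 1 ≤ m`, `Λ_n²/2 ≤ ω_k² + e_K(k⃗)² ≤ 3Λ_n²/4` ⟹
`(8/81)·(4/(3Λ_n²)) ≤ w_{Λ_n}(k)·s_{n,m}(k)·‖ĝ_K(k)‖²` (`w ∈ [1/9, 8/9]`, `s = 1 − w`, `‖ĝ‖² = 1/(ω² + e²) ≥ 4/(3Λ_n²)`). [folklore] -/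
theorem klpf_density_floor [NeZero M] {n m : ℕ} (hnm : n + 1 ≤ m) (k : FreqMomentum L M)
    (hlo : klScale klE0 n ^ 2 / 2 ≤ matsubaraFreq β M k.1 ^ 2 + nambuXiCT L μ K k.2 ^ 2)
    (hhi : matsubaraFreq β M k.1 ^ 2 + nambuXiCT L μ K k.2 ^ 2 ≤ 3 * klScale klE0 n ^ 2 / 4) :
    8 / 81 * (4 / (3 * klScale klE0 n ^ 2)) ≤
      hubbardCutoffWeightCT L M β μ K (klScale klE0 n) k * softSymbolCompl L M β μ K n m k * ‖propCT L M β μ K k‖ ^ 2 := by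
  set Λ := klScale klE0 n with hΛdef
  have hΛ : 0 < Λ := klth_klScale_pos n
  set r := matsubaraFreq β M k.1 ^ 2 + nambuXiCT L μ K k.2 ^ 2 with hr
  have hr0 : 0 < r := by
    have : 0 < Λ ^ 2 / 2 := by positivity
    linarith
  -- the cutoff value
  have hx : 1 / 2 ≤ r / Λ ^ 2 := by rw [le_div_iff₀ (by positivity)]; linarith
  have hx' : r / Λ ^ 2 ≤ 3 / 4 := by rw [div_le_iff₀ (by positivity)]; linarith
  obtain ⟨hw1, hw2⟩ := klpf_salmhoferCutoff_window hx hx'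
  have hw : hubbardCutoffWeightCT L M β μ K Λ k = salmhoferCutoff (r / Λ ^ 2) := rfl
  -- flatness of the lower weight: `s = 1 − w`
  have hflat := klcd_soft_eq_one_sub β μ K hnm k (by simp only [← hr]; nlinarith)
  -- the rung size squared
  have hg : ‖propCT L M β μ K k‖ ^ 2 = r⁻¹ := by
    rw [norm_propCT_eq, ← hr, inv_pow, Real.sq_sqrt hr0.le]
  have hg' : 4 / (3 * Λ ^ 2) ≤ ‖propCT L M β μ K k‖ ^ 2 := by
    rw [hg, ← one_div, div_le_div_iff₀ (by positivity) hr0]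
    linarith
  have hws : 8 / 81 ≤ hubbardCutoffWeightCT L M β μ K Λ k * softSymbolCompl L M β μ K n m k := by
    rw [hflat, hw]
    nlinarith
  calc 8 / 81 * (4 / (3 * Λ ^ 2)) ≤ (hubbardCutoffWeightCT L M β μ K Λ k * softSymbolCompl L M β μ K n m k) * ‖propCT L M β μ K k‖ ^ 2 :=
        mul_le_mul hws hg' (by positivity) ((by norm_num : (0 : ℝ) ≤ 8 / 81).trans hws)
    _ = _ := rfl

/-! ## §3 The pinned floor, conditional on the layer count -/

/-- **Pinned floor of the complementary member's net mass** (`0 < β`, `n + 1 ≤ m`): if the layer `{k : Λ_n²/2 ≤ ω_k² + e_K(k⃗)² ≤ 3Λ_n²/4}` has at least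
`c₀·(βL²)·Λ_n²` frequency–momenta, then `(64/243)·c₀ ≤ −Σ_p t_n[s_{n,m}](0,p)` — the per-step floor `b_lo = 64c₀/243` of S2-ROWS (D3′), uniform in `n, m`. [folklore] -/
theorem klpf_pinned_mass_floor [NeZero M] (hβ : 0 < β) {n m : ℕ} (hnm : n + 1 ≤ m) {c₀ : ℝ}
    (hcount : c₀ * (β * (L : ℝ) ^ 2) * klScale klE0 n ^ 2 ≤
      (((univ : Finset (FreqMomentum L M)).filter fun k =>
        klScale klE0 n ^ 2 / 2 ≤ matsubaraFreq β M k.1 ^ 2 + nambuXiCT L μ K k.2 ^ 2 ∧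
          matsubaraFreq β M k.1 ^ 2 + nambuXiCT L μ K k.2 ^ 2 ≤ 3 * klScale klE0 n ^ 2 / 4).card : ℝ)) :
    64 / 243 * c₀ ≤ -∑ p, klTransferWeight L M β μ K n (softSymbolCompl L M β μ K n m) 0 p := by
  classical
  set Λ := klScale klE0 n with hΛdef
  have hΛ : 0 < Λ := klth_klScale_pos n
  have hL : (1 : ℝ) ≤ L := by exact_mod_cast Nat.one_le_iff_ne_zero.2 (NeZero.ne L)
  have hc : 0 < β * (L : ℝ) ^ 2 := by positivity
  obtain ⟨hev, hev'⟩ := klcd_soft_even (L := L) (M := M) β μ K n m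
  set F : FreqMomentum L M → ℝ := fun k =>
    hubbardCutoffWeightCT L M β μ K Λ k * softSymbolCompl L M β μ K n m k * ‖propCT L M β μ K k‖ ^ 2 with hF
  -- the pinned mass as a double sum of the density
  have hpin : -∑ p, klTransferWeight L M β μ K n (softSymbolCompl L M β μ K n m) 0 p = 2 * (β * (L : ℝ) ^ 2)⁻¹ * ∑ k, F k := by
    rw [← sum_neg_distrib]
    rw [show ∑ k, F k = ∑ p : TorusSite 2 L, ∑ ν : MatsubaraIdx M, F (ν, p) from Fintype.sum_prod_type_right' fun ν p => F (ν, p)]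
    rw [mul_sum]
    refine sum_congr rfl fun p _ => ?_
    rw [klTransferWeight_pin_eq β μ K n hev hev' p, neg_neg]
  -- localise to the layer
  set Lay := (univ : Finset (FreqMomentum L M)).filter fun k =>
    Λ ^ 2 / 2 ≤ matsubaraFreq β M k.1 ^ 2 + nambuXiCT L μ K k.2 ^ 2 ∧ matsubaraFreq β M k.1 ^ 2 + nambuXiCT L μ K k.2 ^ 2 ≤ 3 * Λ ^ 2 / 4 with hLay
  have hmn : n ≤ m := by omega
  have h1 : (Lay.card : ℝ) * (8 / 81 * (4 / (3 * Λ ^ 2))) ≤ ∑ k ∈ Lay, F k := by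
    have := Finset.card_nsmul_le_sum Lay F (8 / 81 * (4 / (3 * Λ ^ 2))) fun k hk => by
      rw [hLay, mem_filter] at hk
      exact klpf_density_floor β μ K hnm k hk.2.1 hk.2.2
    rwa [nsmul_eq_mul] at this
  have h2 : ∑ k ∈ Lay, F k ≤ ∑ k, F k := Finset.sum_le_univ_sum_of_nonneg fun k => klpf_density_nonneg β μ K hmn k
  rw [hpin]
  have h3 : c₀ * (β * (L : ℝ) ^ 2) * Λ ^ 2 * (8 / 81 * (4 / (3 * Λ ^ 2))) ≤ ∑ k, F k :=
    (mul_le_mul_of_nonneg_right hcount (by positivity)).trans (h1.trans h2)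
  have hid : 2 * (β * (L : ℝ) ^ 2)⁻¹ * (c₀ * (β * (L : ℝ) ^ 2) * Λ ^ 2 * (8 / 81 * (4 / (3 * Λ ^ 2)))) = 64 / 243 * c₀ := by
    field_simp
    ring
  rw [← hid]
  exact mul_le_mul_of_nonneg_left h3 (by positivity)

/-! ## §4 The layer contains a frequency window times a level-set window -/

/-- **Product structure of the layer**: `{ν : ω_ν² ≤ Λ²/8} × {p : Λ²/2 ≤ e_K(p)² ≤ 5Λ²/8} ⊆ layer`, hence `#freq · #shell ≤ #layer` — a Matsubara count times a
LEVEL-SET FLOOR discharges the hypothesis of `klpf_pinned_mass_floor`. [folklore] -/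
theorem klpf_layer_card_ge (β Λ : ℝ) :
    ((univ : Finset (MatsubaraIdx M)).filter fun ν => matsubaraFreq β M ν ^ 2 ≤ Λ ^ 2 / 8).card *
        ((univ : Finset (TorusSite 2 L)).filter fun p => Λ ^ 2 / 2 ≤ nambuXiCT L μ K p ^ 2 ∧ nambuXiCT L μ K p ^ 2 ≤ 5 * Λ ^ 2 / 8).card ≤
      ((univ : Finset (FreqMomentum L M)).filter fun k =>
        Λ ^ 2 / 2 ≤ matsubaraFreq β M k.1 ^ 2 + nambuXiCT L μ K k.2 ^ 2 ∧ matsubaraFreq β M k.1 ^ 2 + nambuXiCT L μ K k.2 ^ 2 ≤ 3 * Λ ^ 2 / 4).card := by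
  classical
  rw [← Finset.card_product]
  refine Finset.card_le_card fun k hk => ?_
  rw [Finset.mem_product, mem_filter, mem_filter] at hk
  obtain ⟨⟨-, hν⟩, -, hp1, hp2⟩ := hk
  rw [mem_filter]
  have h0 : 0 ≤ matsubaraFreq β M k.1 ^ 2 := sq_nonneg _
  exact ⟨mem_univ _, by linarith, by linarith⟩

end Floor

end Summit.HubbardSuperconductivity.HubbardSuperconductivity.Theorems.KLRegimeSplit

end
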